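import Literature.MathematicalPhysics.QuantumFieldTheory.ElectricFluxPositivity
import HarnessLib

/-!
# Reflection positivity through sites of the centrally twisted Wilson measures

Topic `Literature/MathematicalPhysics/QuantumFieldTheory`; theorem-only sequel of `CentralInsertionSiteRP.lean`
(namespace `InsertionSiteRP`: the site reflection `Θ'` = `GaugeConfig.negReflect`, the reflected insertion
`reflectInsertion u`, the half observable `halfObs`, the gluing identity
`exp_mul_halfObs_negReflect_mul_halfObs`) and of the site-reflection-positivity theorem of the UNTWISTED Wilson
measure, `integral_siteIntegrand_nonneg` (`ConstructiveQFTWave0SiteRPProofs.lean`).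

## What is proved (everything; no facts, no definitions)

K. R. Ito and E. Seiler, *On the recent paper on quark confinement by Tomboulis*, arXiv:0711.4930
[ItoSeiler2007Tomboulis], §2 Thm 2.2: «Assume `c_j ≥ 0`. Then (1) the measure `dμ_Λ = ∏_p (1 + Σ_{j≠0} c_j
d_j χ_j(U_p)) dU_Λ` is reflection positive with respect to all planes dividing the periodic box `Λ`. (2) The
measure `dμ⁺_Λ = [∏_p (1 + Σ c_j d_j χ_j(U_p)) + ∏_p (1 + Σ c_j d_j χ_j((-1)^{ν(p)} U_p))] dU_Λ` is reflection
positive with respect to all planes without bisecting `V ⊂ Λ`» (`V` the vortex, a coclosed stack of plaquettes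
of one plane; «It is easy to see that»).  T. Kanazawa, Ann. Phys. 324 (2009) 1634 [Kanazawa2008], §2 proof of
Lemma 2, eq. (15): `θ[𝒪^{[k]}[𝒱]] = 𝒪^{[-k]}[𝒱^θ]` — «the orientation of plaquettes are reversed by
reflection».

Here, for the WILSON action (all `c_j ≥ 0`) and the reflection `Θ'` THROUGH the time slices `t = 0`, `t = L/2`
of the even torus `(ℤ/Lℤ)^d`, the twisted form of (1)/(2) is proved for EVERY centre-valued plaquette insertion
`s` which is its own reflection (`reflectInsertion s = s`: `s` inverted-and-reflected on temporal plaquettes,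
reflected on spatial ones) — in particular for every insertion living on SPATIAL plaquettes only and not
depending on the time coordinate, such as the insertion of an arbitrary purely spatial ('magnetic') 't Hooft
twist (`MultiTwist.spatialPart z = z`; its stacks extend over all times, i.e. they ARE met — «bisected» — by
the two reflection hyperplanes, and `Θ'` carries spatial plaquettes along WITHOUT reversing their orientation,
so the twist rides along whatever the order of the centre element):

* ★ `InsertionSiteRP.integral_twisted_siteIntegrand_nonneg`:
  `0 ≤ ∫ e^{-β S_s(U)} conj F(Θ'U) F(U) ∏ dU` for every real `β`, every bounded measurable `F` depending on
  the links of the closed positive half, every central `Θ'`-symmetric `s` — from the untwisted theorem applied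
  to `F · F_s` and the gluing identity `e^{-βS} F_s(Θ'U) F_s(U) = e^{-βS_{glue(s,s)}} = e^{-βS_s}`
  (`glueInsertion_self`);
* `InsertionSiteRP.integral_add_twisted_siteIntegrand_nonneg`: the Ito–Seiler form (2), `e^{-βS} + e^{-βS_s}`;
* `MultiTwist.integral_twist_siteIntegrand_nonneg`: the twisted Wilson weight `e^{-β S_z}` of every purely
  spatial twist `z` (`spatialPart z = z`, any compact `G`, the insertion `p ↦ (plaquetteTwist z p)⁻¹` of
  `TwistedSector.twistZ`) is site-reflection positive;
* `MultiTwist.sun_integral_twist_siteIntegrand_nonneg`: the `SU(N)` case, `z = twistOfTensor N m` with `m`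
  purely magnetic (`m_{0j} = 0`).

Scope / HONEST FRAMING: finite torus, `L` even, reflection direction = coordinate `0` of the tree's site-RP
theorem, Wilson action; Ito–Seiler state (1)–(2) for general character expansions with `c_j ≥ 0` and for all
reflection planes (links and sites) — only the Wilson/site/symmetric-insertion case is asserted here, and
nothing is claimed for reflection hyperplanes having the vortex on one side.  Insertions through temporal
planes are NOT `Θ'`-symmetric and are not covered (for them `CentralInsertionSiteRP.sum_sum_glue_nonneg` is the
correct statement).

## References
* K. R. Ito, E. Seiler, arXiv:0711.4930 (2007), §2 Thm 2.2. [ItoSeiler2007Tomboulis]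
* T. Kanazawa, Ann. Phys. 324 (2009) 1634–1665, §2 Lemma 2 eqs. (15)–(17). [Kanazawa2008]
* G. 't Hooft, Nucl. Phys. B153 (1979) 141–160, §2 eqs. (2.5)–(2.6) (the twist `n_{μν}`). [tHooft1979Flux]
* J. Fröhlich, R. Israel, E. H. Lieb, B. Simon, Comm. Math. Phys. 62 (1978) 1, Thm. 2.1 (RP through sites). [folklore]
-/

open MeasureTheory Finset Complex
open scoped ComplexConjugate ComplexOrder BigOperators

namespace Literature.MathematicalPhysics.QuantumFieldTheory

noncomputable section

namespace InsertionSiteRP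

open WilsonRP WilsonSiteRP

/-! ## Auxiliary bounds on the half observable (private in `CentralInsertionSiteRP.lean`; re-proved) -/

section Aux

variable {d L N : ℕ} [NeZero d] [NeZero L] {G : Type*} [Group G] (ρ : G →* Matrix (Fin N) (Fin N) ℂ)

omit [NeZero d] in
/-- `1 < L` for an even non-zero `L`. [folklore] -/
private theorem one_lt_of_even_aux (hL : Even L) : 1 < L := by
  obtain ⟨r, hr⟩ := hL
  have := NeZero.ne L
  omega

omit [NeZero d] [NeZero L] in
/-- Measurability of the inserted plaquette energy (through the matrix entries of `ρ`). [folklore] -/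
private theorem measurable_plaqReIns_aux [TopologicalSpace G] [IsTopologicalGroup G] [MeasurableSpace G]
    [BorelSpace G] (hρ : Continuous ρ) (u : Plaquette d L → G) (p : Plaquette d L) :
    Measurable fun U : GaugeConfig d L G => plaqReIns ρ u U p := by
  unfold plaqReIns plaquetteHolonomy
  have hconst : EntryMeasurable ρ fun _ : GaugeConfig d L G => u p := fun _ _ => measurable_const
  exact (hconst.mul ((((entryMeasurable_apply hρ _).mul (entryMeasurable_apply hρ _)).mul
    (entryMeasurable_apply_inv hρ _)).mul (entryMeasurable_apply_inv hρ _))).measurable_trace_re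

variable [TopologicalSpace G] [IsTopologicalGroup G] [CompactSpace G]

omit [NeZero d] [NeZero L] in
/-- `|Re tr ρ(u_p U_p)| ≤ N`. [folklore] -/
private theorem abs_plaqReIns_le_aux (hρ : Continuous ρ) (u : Plaquette d L → G) (U : GaugeConfig d L G)
    (p : Plaquette d L) : |plaqReIns ρ u U p| ≤ N := by
  have h := Literature.RepresentationTheory.CompactGroups.CompactGroup.abs_re_trace_le_card ρ hρ
    (u p * plaquetteHolonomy U p.1 p.2.1.1 p.2.1.2)
  rwa [Fintype.card_fin] at h

omit [CompactSpace G] in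
/-- Measurability of the half observable. [folklore] -/
private theorem measurable_halfObs_aux [MeasurableSpace G] [BorelSpace G] (hρ : Continuous ρ) (β : ℝ)
    (u : Plaquette d L → G) : Measurable (halfObs (d := d) (L := L) ρ β u) := by
  unfold halfObs halfExponent
  refine Real.measurable_exp.comp (Measurable.const_mul (Measurable.add ?_ (Measurable.const_mul ?_ _)) β)
  · exact Finset.measurable_sum _ fun p _ =>
      (measurable_plaqReIns_aux ρ hρ u p).sub (measurable_plaqRe ρ hρ p)
  · exact Finset.measurable_sum _ fun p _ =>
      (measurable_plaqReIns_aux ρ hρ u p).sub (measurable_plaqRe ρ hρ p)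

/-- `|halfExponent| ≤ |β| · 3N · #plaquettes`. [folklore] -/
private theorem abs_halfExponent_le_aux (hρ : Continuous ρ) (β : ℝ) (u : Plaquette d L → G)
    (U : GaugeConfig d L G) :
    |halfExponent ρ β u U| ≤ |β| * (3 * N * Fintype.card (Plaquette d L)) := by
  unfold halfExponent
  rw [abs_mul]
  refine mul_le_mul_of_nonneg_left ?_ (abs_nonneg β)
  have hterm : ∀ p : Plaquette d L, |plaqReIns ρ u U p - plaqRe ρ U p| ≤ 2 * N := fun p => by
    have h1 := abs_plaqReIns_le_aux ρ hρ u U p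
    have h2 := abs_plaqRe_le ρ hρ U p
    calc |plaqReIns ρ u U p - plaqRe ρ U p| ≤ |plaqReIns ρ u U p| + |plaqRe ρ U p| := abs_sub _ _
      _ ≤ N + N := add_le_add h1 h2
      _ = 2 * N := by ring
  have hsum : ∀ s : Finset (Plaquette d L),
      |∑ p ∈ s, (plaqReIns ρ u U p - plaqRe ρ U p)| ≤ 2 * N * Fintype.card (Plaquette d L) := fun s =>
    calc |∑ p ∈ s, (plaqReIns ρ u U p - plaqRe ρ U p)| ≤ ∑ p ∈ s, |plaqReIns ρ u U p - plaqRe ρ U p| :=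
          Finset.abs_sum_le_sum_abs _ _
      _ ≤ ∑ _p ∈ s, (2 * N : ℝ) := Finset.sum_le_sum fun p _ => hterm p
      _ ≤ ∑ _p : Plaquette d L, (2 * N : ℝ) :=
          Finset.sum_le_sum_of_subset_of_nonneg (Finset.subset_univ _) fun _ _ _ => by positivity
      _ = 2 * N * Fintype.card (Plaquette d L) := by
          rw [Finset.sum_const, Finset.card_univ, nsmul_eq_mul]; ring
  have hA := hsum (univ.filter IsSitePosPlaq)
  have hB := hsum (univ.filter IsSharedPlaq)
  have hN : (0 : ℝ) ≤ N * Fintype.card (Plaquette d L) := by positivity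
  calc |∑ p ∈ univ.filter IsSitePosPlaq, (plaqReIns ρ u U p - plaqRe ρ U p) +
        1 / 2 * ∑ p ∈ univ.filter IsSharedPlaq, (plaqReIns ρ u U p - plaqRe ρ U p)|
      ≤ |∑ p ∈ univ.filter IsSitePosPlaq, (plaqReIns ρ u U p - plaqRe ρ U p)| +
          |1 / 2 * ∑ p ∈ univ.filter IsSharedPlaq, (plaqReIns ρ u U p - plaqRe ρ U p)| := abs_add_le _ _
    _ ≤ 2 * N * Fintype.card (Plaquette d L) + 1 / 2 * (2 * N * Fintype.card (Plaquette d L)) := by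
        rw [abs_mul, abs_of_pos (by norm_num : (0 : ℝ) < 1 / 2)]
        exact add_le_add hA (mul_le_mul_of_nonneg_left hB (by norm_num))
    _ = 3 * N * Fintype.card (Plaquette d L) := by ring

/-- `0 < halfObs ≤ exp(|β| · 3N · #plaquettes)`. [folklore] -/
private theorem halfObs_pos_le_aux (hρ : Continuous ρ) (β : ℝ) (u : Plaquette d L → G)
    (U : GaugeConfig d L G) :
    0 < halfObs ρ β u U ∧ halfObs ρ β u U ≤ Real.exp (|β| * (3 * N * Fintype.card (Plaquette d L))) :=
  ⟨Real.exp_pos _, Real.exp_le_exp.2 ((le_abs_self _).trans (abs_halfExponent_le_aux ρ hρ β u U))⟩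

omit [TopologicalSpace G] [IsTopologicalGroup G] [CompactSpace G] in
/-- The half observable depends only on the links of the closed positive half. [folklore] -/
private theorem dependsOn_halfObs_aux [Fact (1 < L)] (hL : Even L) (β : ℝ) (u : Plaquette d L → G) :
    DependsOn (halfObs ρ β u)
      ((sitePosEdges ∪ sharedEdges : Finset (Edge d L)) : Set (Edge d L)) := by
  intro U V hUV
  have h : ∀ e, IsSitePosEdge e ∨ IsSharedEdge e → U e = V e := fun e he => hUV e (by
    rcases he with he | he <;> simp [he])
  have hP : ∀ p ∈ univ.filter IsSitePosPlaq, plaqReIns ρ u U p - plaqRe ρ U p =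
      plaqReIns ρ u V p - plaqRe ρ V p := fun p hp => by
    rw [Finset.mem_filter] at hp
    obtain ⟨h1, h2, h3, h4⟩ := edges_of_isSitePosPlaq hL hp.2
    simp only [plaqReIns, plaqRe, plaquetteHolonomy, h _ h1, h _ h2, h _ h3, h _ h4]
  have hS : ∀ p ∈ univ.filter IsSharedPlaq, plaqReIns ρ u U p - plaqRe ρ U p =
      plaqReIns ρ u V p - plaqRe ρ V p := fun p hp => by
    rw [Finset.mem_filter] at hp
    obtain ⟨h1, h2, h3, h4⟩ := edges_of_isSharedPlaq hp.2
    simp only [plaqReIns, plaqRe, plaquetteHolonomy, h _ (Or.inr h1), h _ (Or.inr h2),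
      h _ (Or.inr h3), h _ (Or.inr h4)]
  unfold halfObs halfExponent
  rw [Finset.sum_congr rfl hP, Finset.sum_congr rfl hS]

end Aux

/-! ## Reflection positivity of the twisted weights -/

section Twisted

variable {d L N : ℕ} [NeZero d] [NeZero L] {G : Type*} [Group G] [TopologicalSpace G]
  [IsTopologicalGroup G] [CompactSpace G] [MeasurableSpace G] [BorelSpace G]
  (ρ : G →* Matrix (Fin N) (Fin N) ℂ)

omit [NeZero L] [TopologicalSpace G] [IsTopologicalGroup G] [CompactSpace G] [MeasurableSpace G]
  [BorelSpace G] in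
/-- A `Θ'`-symmetric insertion glued to itself is itself: `glue(s,s) = s` when `sᶿ = s` (Kanazawa's
`𝒱^θ = 𝒱` for a vortex met by the reflection plane). [cite: Kanazawa2008, §2 Lemma 2 eqs. (15)–(17)] -/
theorem glueInsertion_self {s : Plaquette d L → G} (hsymm : reflectInsertion s = s) :
    glueInsertion s s = s := by
  funext p
  by_cases hp : IsSiteNegPlaq p
  · rw [glueInsertion_of_neg s s hp, hsymm]
  · exact glueInsertion_of_not_neg s s hp

/-- ★ **Reflection positivity through sites of the twisted Wilson weight** (Ito–Seiler 2007 Thm 2.2 for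
the Wilson action, the site reflection `Θ'` and a reflection-symmetric central insertion): for `L` even,
every real `β`, every centre-valued insertion `s` with `reflectInsertion s = s`, and every bounded measurable
`F` depending on the links of the closed positive half,
`0 ≤ ∫ e^{-β S_s(U)} conj F(Θ'U) F(U) ∏ dU`.  Proof: `e^{-βS_s(U)} = e^{-βS(U)} F_s(Θ'U) F_s(U)` (gluing
identity with `glue(s,s) = s`, `F_s = halfObs` real, positive, a function of the closed positive half), so the
integral is the untwisted site-RP sandwich of `F · F_s`. [cite: ItoSeiler2007Tomboulis, §2 Thm 2.2]
[cite: Kanazawa2008, §2 Lemma 2 eqs. (15)–(17)] -/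
theorem integral_twisted_siteIntegrand_nonneg (hL : Even L) (hρ : Continuous ρ) (β : ℝ)
    {s : Plaquette d L → G} (hs : ∀ p, s p ∈ Subgroup.center G) (hsymm : reflectInsertion s = s)
    {F : GaugeConfig d L G → ℂ} (hF : Measurable F) {CF : ℝ} (hFb : ∀ U, ‖F U‖ ≤ CF)
    (hFdep : DependsOn F ((sitePosEdges ∪ sharedEdges : Finset (Edge d L)) : Set (Edge d L))) :
    0 ≤ ∫ U : GaugeConfig d L G, (Real.exp (-(β * insertedWilsonAction ρ s U)) : ℂ) *
      (conj (F U.negReflect) * F U) ∂(LatticeRP.piMeasure (haarProbability G)) := by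
  haveI : Fact (1 < L) := ⟨one_lt_of_even_aux hL⟩
  set Fs : GaugeConfig d L G → ℂ := fun U => ((halfObs ρ β s U : ℝ) : ℂ) * F U with hFs
  have hFsm : Measurable Fs :=
    (Complex.measurable_ofReal.comp (measurable_halfObs_aux ρ hρ β s)).mul hF
  have hFsb : ∀ U, ‖Fs U‖ ≤ Real.exp (|β| * (3 * N * Fintype.card (Plaquette d L))) * CF := fun U => by
    obtain ⟨hpos, hle⟩ := halfObs_pos_le_aux ρ hρ β s U
    rw [hFs, norm_mul, Complex.norm_real, Real.norm_eq_abs, abs_of_pos hpos]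
    exact mul_le_mul hle (hFb U) (norm_nonneg _) (Real.exp_pos _).le
  have hFsdep : DependsOn Fs ((sitePosEdges ∪ sharedEdges : Finset (Edge d L)) : Set (Edge d L)) := by
    intro U V hUV
    simp only [hFs]
    rw [dependsOn_halfObs_aux ρ hL β s hUV, hFdep hUV]
  have hRP := integral_siteIntegrand_nonneg ρ hL hρ β hFsm hFsb hFsdep
  have hpt : ∀ U : GaugeConfig d L G,
      (Real.exp (-β * wilsonAction ρ U) : ℂ) * (conj (Fs U.negReflect) * Fs U) =
      (Real.exp (-(β * insertedWilsonAction ρ s U)) : ℂ) * (conj (F U.negReflect) * F U) := fun U => by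
    have h := exp_mul_halfObs_negReflect_mul_halfObs ρ hL hρ β hs (v := s) (fun p _ => rfl) U
    rw [glueInsertion_self hsymm] at h
    simp only [hFs, map_mul, Complex.conj_ofReal]
    rw [← h]
    push_cast
    ring
  simp only [hpt] at hRP
  exact hRP

/-- **The Ito–Seiler form** (Thm 2.2 (2): the symmetrised measure `dμ⁺ = [e^{-βS} + e^{-βS_s}] ∏ dU` of
`Z + Z⁻`-type is reflection positive), for the Wilson action, the site reflection `Θ'` and a central
`Θ'`-symmetric insertion `s`: `0 ≤ ∫ (e^{-βS(U)} + e^{-βS_s(U)}) conj F(Θ'U) F(U) ∏ dU`.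
[cite: ItoSeiler2007Tomboulis, §2 Thm 2.2] -/
theorem integral_add_twisted_siteIntegrand_nonneg (hL : Even L) (hρ : Continuous ρ) (β : ℝ)
    {s : Plaquette d L → G} (hs : ∀ p, s p ∈ Subgroup.center G) (hsymm : reflectInsertion s = s)
    {F : GaugeConfig d L G → ℂ} (hF : Measurable F) {CF : ℝ} (hFb : ∀ U, ‖F U‖ ≤ CF)
    (hFdep : DependsOn F ((sitePosEdges ∪ sharedEdges : Finset (Edge d L)) : Set (Edge d L))) :
    0 ≤ ∫ U : GaugeConfig d L G, ((Real.exp (-(β * insertedWilsonAction ρ 1 U)) : ℂ) +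
        (Real.exp (-(β * insertedWilsonAction ρ s U)) : ℂ)) *
      (conj (F U.negReflect) * F U) ∂(LatticeRP.piMeasure (haarProbability G)) := by
  set μ : Measure (GaugeConfig d L G) := LatticeRP.piMeasure (haarProbability G) with hμ
  -- integrability of the two sandwiches (bounded measurable on a probability space)
  have hGm : Measurable fun U : GaugeConfig d L G => conj (F U.negReflect) * F U :=
    (Complex.continuous_conj.measurable.comp (hF.comp measurable_negReflect)).mul hF
  have hGb : ∀ U : GaugeConfig d L G, ‖conj (F U.negReflect) * F U‖ ≤ CF * CF := fun U => by
    rw [norm_mul, Complex.norm_conj]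
    have h0 : 0 ≤ CF := (norm_nonneg _).trans (hFb U)
    exact mul_le_mul (hFb _) (hFb _) (norm_nonneg _) h0
  have hint : ∀ t : Plaquette d L → G, Integrable (fun U : GaugeConfig d L G =>
      (Real.exp (-(β * insertedWilsonAction ρ t U)) : ℂ) * (conj (F U.negReflect) * F U)) μ := by
    intro t
    refine Integrable.mono' (g := fun _ => Real.exp (|β| * (2 * N * Fintype.card (Plaquette d L))) *
      (CF * CF)) (integrable_const _) ?_ (ae_of_all _ fun U => ?_)
    · exact ((Complex.measurable_ofReal.comp (Real.measurable_exp.comp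
        ((measurable_insertedWilsonAction ρ hρ t).const_mul β).neg)).mul hGm).aestronglyMeasurable
    · rw [norm_mul, Complex.norm_real, Real.norm_eq_abs, abs_of_pos (Real.exp_pos _)]
      refine mul_le_mul ?_ (hGb U) (norm_nonneg _) (Real.exp_pos _).le
      refine Real.exp_le_exp.2 ?_
      calc -(β * insertedWilsonAction ρ t U) ≤ |β * insertedWilsonAction ρ t U| := neg_le_abs _
        _ = |β| * |insertedWilsonAction ρ t U| := abs_mul _ _
        _ ≤ |β| * (2 * N * Fintype.card (Plaquette d L)) :=
            mul_le_mul_of_nonneg_left (abs_insertedWilsonAction_le ρ hρ t U) (abs_nonneg _)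
  simp_rw [add_mul]
  rw [integral_add (hint 1) (hint s)]
  refine add_nonneg ?_ (integral_twisted_siteIntegrand_nonneg ρ hL hρ β hs hsymm hF hFb hFdep)
  exact integral_twisted_siteIntegrand_nonneg ρ hL hρ β (s := 1) (fun _ => Subgroup.one_mem _)
    reflectInsertion_one hF hFb hFdep

end Twisted

end InsertionSiteRP

/-! ## Reflection positivity of 't Hooft's magnetically twisted measures -/

namespace MultiTwist

open WilsonRP WilsonSiteRP InsertionSiteRP QuantumLattice

section General

variable {d L N : ℕ} [NeZero d] [NeZero L] {G : Type*} [Group G] [TopologicalSpace G]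
  [IsTopologicalGroup G] [CompactSpace G] [MeasurableSpace G] [BorelSpace G]
  (ρ : G →* Matrix (Fin N) (Fin N) ℂ)

/-- **The Wilson measure twisted by a purely spatial ('magnetic') 't Hooft twist is site-reflection
positive**: for `L` even, every real `β`, every twist `z` with `spatialPart z = z` (no twist in the temporal
planes `(0, j)`; the spatial stacks extend over all times and are carried along by `Θ'` without reversal of
orientation — any compact `G`, centre elements of any order) and every bounded measurable `F` of the links of
the closed positive half, `0 ≤ ∫ e^{-β S_z(U)} conj F(Θ'U) F(U) ∏ dU`, `S_z` the action with the insertion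
`p ↦ (plaquetteTwist z p)⁻¹` of `TwistedSector.twistZ`. [cite: ItoSeiler2007Tomboulis, §2 Thm 2.2]
[cite: tHooft1979Flux, §2 eqs. (2.5)–(2.6)] -/
theorem integral_twist_siteIntegrand_nonneg (hL : Even L) (hρ : Continuous ρ) (β : ℝ) {z : Twist d G}
    (hz : spatialPart z = z) {F : GaugeConfig d L G → ℂ} (hF : Measurable F) {CF : ℝ}
    (hFb : ∀ U, ‖F U‖ ≤ CF)
    (hFdep : DependsOn F ((sitePosEdges ∪ sharedEdges : Finset (Edge d L)) : Set (Edge d L))) :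
    0 ≤ ∫ U : GaugeConfig d L G,
      (Real.exp (-(β * insertedWilsonAction ρ (fun p => (plaquetteTwist z p)⁻¹) U)) : ℂ) *
        (conj (F U.negReflect) * F U) ∂(LatticeRP.piMeasure (haarProbability G)) := by
  have hsymm := reflectInsertion_spatialPart (L := L) z
  rw [hz] at hsymm
  exact integral_twisted_siteIntegrand_nonneg ρ hL hρ β (plaquetteTwist_inv_mem_center z) hsymm hF hFb
    hFdep

/-- The same for the spatial part of an arbitrary twist. [cite: ItoSeiler2007Tomboulis, §2 Thm 2.2] -/
theorem integral_twist_spatialPart_siteIntegrand_nonneg (hL : Even L) (hρ : Continuous ρ) (β : ℝ)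
    (z : Twist d G) {F : GaugeConfig d L G → ℂ} (hF : Measurable F) {CF : ℝ} (hFb : ∀ U, ‖F U‖ ≤ CF)
    (hFdep : DependsOn F ((sitePosEdges ∪ sharedEdges : Finset (Edge d L)) : Set (Edge d L))) :
    0 ≤ ∫ U : GaugeConfig d L G,
      (Real.exp (-(β * insertedWilsonAction ρ (fun p => (plaquetteTwist (spatialPart z) p)⁻¹) U)) : ℂ) *
        (conj (F U.negReflect) * F U) ∂(LatticeRP.piMeasure (haarProbability G)) :=
  integral_twist_siteIntegrand_nonneg ρ hL hρ β (spatialPart_spatialPart z) hF hFb hFdep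

end General

section SUN

variable {N n : ℕ}

/-- **The `SU(N)` case**: the Wilson measure of the fundamental representation twisted by a purely magnetic
't Hooft tensor `m` (`m_{0j} = 0`) is site-reflection positive on the even symmetric torus `(ℤ/Lℤ)^{n+1}`,
at every coupling. [cite: ItoSeiler2007Tomboulis, §2 Thm 2.2] [cite: tHooft1979Flux, §2 eqs. (2.5)–(2.6)] -/
theorem sun_integral_twist_siteIntegrand_nonneg {L : ℕ} [NeZero L] (hL : Even L) (β : ℝ)
    {m : QuantumLattice.Plane (n + 1) → ZMod N}
    (hm : ∀ q : QuantumLattice.Plane (n + 1), q.1.1 = 0 → m q = 0)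
    {F : GaugeConfig (n + 1) L (Matrix.specialUnitaryGroup (Fin N) ℂ) → ℂ} (hF : Measurable F) {CF : ℝ}
    (hFb : ∀ U, ‖F U‖ ≤ CF)
    (hFdep : DependsOn F ((sitePosEdges ∪ sharedEdges : Finset (Edge (n + 1) L)) : Set (Edge (n + 1) L))) :
    0 ≤ ∫ U : GaugeConfig (n + 1) L (Matrix.specialUnitaryGroup (Fin N) ℂ),
      (Real.exp (-(β * insertedWilsonAction (fundamentalRep (Fin N))
        (fun p => (plaquetteTwist (twistOfTensor N m) p)⁻¹) U)) : ℂ) *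
        (conj (F U.negReflect) * F U)
        ∂(LatticeRP.piMeasure (haarProbability (Matrix.specialUnitaryGroup (Fin N) ℂ))) :=
  integral_twist_siteIntegrand_nonneg (fundamentalRep (Fin N)) hL (continuous_fundamentalRep (Fin N)) β
    (spatialPart_twistOfTensor_of_magnetic hm) hF hFb hFdep

end SUN

end MultiTwist

end

end Literature.MathematicalPhysics.QuantumFieldTheory
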